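import Mathlib

/-!
# `Balaban1983to89.B6SectA` — T. Bałaban, *Propagators and renormalization transformations for lattice gauge
theories. II*, Commun. Math. Phys. **96**, 223–250 (1984) [Balaban1984PropagatorsII] (cell paper B6; held
`paper:balaban1984-cmp96-propagators-rt-ii`, journal page = PDF page + 222), **Sect. A, displays (2.5)–(2.35)**: the
constrained variational problem, the multi-scale gauge fixing `R∂*A = 0`, the operators `R`, `Δ′_a`, `G′`, `𝒢`, `Δ_a`,
`Q`, `G`, `H`, and the generator identity (2.37)–(2.38) of Sect. B — the part of the paper that the ninety-odd sibling
modules `…Balaban1983to89.B6*` (which start at the geometry (2.1)–(2.4)/(2.36)/(2.45) ff. and at Lemma 2.1) do not type.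

HONEST FRAMING (mega-formalization `lit-balaban`, reader/typer r03): statement-level skeleton of published theorems with
citation tags; proofs where landed; nothing here is a claim about the Yang–Mills mass gap.  The series' end-statement is
under adjudication by the audit cell `pub-balaban`; this module asserts nothing of it.  Every quotation below was read from
the ×2 page renders `run/shared/lean/pub/pub-balaban/b2b-balaban-ref1/pages/1984-cmp96-propagators-rt-II/…-p002…p007,
p010-x2.png` (pp. 224–229, 232) AS IMAGES, not from the OCR layer.  No sibling module is modified or imported (Mathlib only);
the objects named in docstrings by tree name (`B1.aSeq`, `B4` (2.27), `B5.hk_props`, `B5.neumann_resummation`,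
`B6.neumann_majorant`, `B6.LocalOp.Repr2129`) are cross-references, not dependencies.

WHAT THE PAPER PRINTS (Sect. A, pp. 224–229; verbatim).
* (2.5)–(2.7) p. 224: *"We consider the functional A → Σ_p η^d|(∂A)(p)|² (2.5) for A fixed outside Ω₁ and with fixed
  averages inside Ω₁, more exactly A = B₀ on Λ₀, Q_jA = B_j on Λ_j, j = 1, …, k. (2.6) The functional and the conditions
  are invariant with respect to gauge transformations λ : A → A^λ = A − ∂λ such that λ = 0 on Λ₀, Q′_jλ = 0 on Λ_j,
  j = 1, …, k. (2.7)"*; (2.8)–(2.9): the gauge is fixed by minimising Σ_x η^d|(∂*A^λ)(x)|² = Σ_x η^d|(∂*A)(x) − (Δλ)(x)|²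
  over (2.7); (2.10) p. 225: *"N(Q′) = {λ : λ satisfies (2.7)}, and let R be an orthogonal projection in the space L²(T_η)
  onto the subspace ΔN(Q′). Equation (2.9) implies Δλ₀ = R∂*A, and this equation has exactly one solution because the
  Laplace operator Δ is positive on the subspace N(Q′), hence it is invertible on this subspace. More exactly we have
  the inequality ⟨λ, Δλ⟩ ≥ π² Σ_{j=1}^k (L^jη)^{−2} Σ_{x∈B^j(Λ_j)} η^d|λ(x)|², λ ∈ N(Q′), (2.11) as it follows from
  [3, 2.26, and 2.27]. Thus the functional (2.8) has exactly one minimum on each orbit. This minimum satisfies the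
  equation R∂*A^{λ₀} = 0, or R∂*A = 0 if we take A^{λ₀} as A. (2.12)"*
* (2.13)–(2.17) p. 225: *"a value Rf of the operator R acting on a function f defined on T_η is equal to Δλ, where λ is a
  minimum of the functional λ ∈ N(Q′), λ → Σ_x η^d|f(x) − (Δλ)(x)|² = Σ_x η^d|f(x) − (Δ′_aλ)(x)|², (2.13) and where
  Δ′_a = Δ + Q′*aQ′ and the operator Q′*aQ′ is given by the quadratic form ⟨λ, Q′*aQ′λ⟩ = Σ_{j=0}^k Σ_{y∈Λ_j}
  a_j(L^jη)^{d−2}|(Q′_jλ)(y)|². (2.14) The numbers a_j satisfy the recursive equations a_{j+1} = aa_j/(aL^{−2} + a_j),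
  a₁ = a (see [1, 2.13 and 2.15]), and we assume that (Q′₀λ)(x) = λ(x), x ∈ Λ₀. … The first equation gives
  λ = Δ′_a^{−1}f − Δ′_a^{−2}Q′*ω = G′f − G′²Q′*ω, from the second we get Q′λ = Q′G′f − Q′G′²Q′*ω = 0, hence
  ω = (Q′G′²Q′*)^{−1}Q′G′f and λ = G′f − G′²Q′*(Q′G′²Q′*)^{−1}Q′G′f. Of course Q′λ = 0, hence
  Rf = Δλ = Δ′_aλ = f − G′Q′*(Q′G′²Q′*)^{−1}Q′G′f. (2.17)"*
* (2.18)–(2.23) p. 226: *"h(A, λ, ω) = ½⟨A, Δ_aA⟩ − ½a⟨B, B⟩ − ⟨λ, R∂*A⟩ − ⟨ω, QA − B⟩, Rλ = λ, (2.18) where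
  Δ_a = ∂*∂ + ∂R∂* + Q*aQ = Δ − ∂P∂* + Q*aQ, (2.19) and the operator Q is given by (QA)(b) = (Q_jA)(b) for b ∈ Λ_j,
  (Q₀A)(b) = A(b). (2.20) … δh/δA = Δ_aA − ∂Rλ − Q*ω = 0, δh/δλ = −R∂*A = 0, δh/δω = −(QA − B) = 0. (2.21) One of
  our main results will be that the operator Δ_a is bounded from below by a positive constant, hence the first equation
  implies A = G∂Rλ + GQ*ω, G = Δ_a^{−1}. (2.22) The second and third equations can be written as
  R∂*G∂Rλ + R∂*GQ*ω = 0, QG∂Rλ + QGQ*ω = B. (2.23)"*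
* (2.26)–(2.27), (2.31), (2.34)–(2.35) pp. 226–228: *"R = Δ𝒢Δ. (2.26) It is easy to see that
  𝒢 = G′² − G′²Q′*(Q′G′²Q′*)^{−1}Q′G′². (2.27) This formula, the equality (2.26) and the equalities Q′𝒢 = 𝒢Q′* = 0 imply
  the representation (2.17). … Thus R∂*G∂R = R. (2.31) … Hence we have R∂*GQ* = 0, QG∂R = 0. (2.34) The equalities
  (2.31), (2.34) are generalizations of the equalities (1.97), (1.95) in [4] and can be applied now to Eqs. (2.23). The
  first equation is simply Rλ = λ = 0, and the second is QGQ*ω = B. The operator G is positive, hence QGQ* is positive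
  also and an inverse is a well-defined and positive operator. We get ω = (QGQ*)^{−1}B, and from (2.22) we obtain finally
  A = HB = GQ*(QGQ*)^{−1}B. (2.35) Thus we have proved that there exists exactly one solution of the equations (2.21),
  hence exactly one critical configuration of (2.5) satisfying (2.6), (2.12), and given by (2.35). The only assumption we
  have used was the positivity of the operator Δ_a, a > 0, or G. This will be proven later."*
* (2.37)–(2.38) p. 229: *"G′₀ = Σ_□ h_□G′(□)h_□, (2.37) where G′(□) is an inverse of Δ′_a with some boundary conditions
  on the boundary of □ … Δ′_aG′₀ = I − Σ_□ K(h_□)G′(□)h_□ = I − R, (2.38)"* with Σ_{□∈𝒟} h²_□ = 1 (2.36); p. 232: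
  *"G′ = G′₀(I − R)^{−1} = G′₀ Σ_{n=0}^∞ Rⁿ (2.50)"*.

WHAT IS TYPED AND WHAT IS PROVED (0 sorry; 0 new named facts — every statement below is a definition with a body or a
kernel-checked theorem of finite-dimensional linear algebra, which is exactly the content of the printed arguments once
the analytic inputs are named as hypotheses):
1. ABSTRACT OPERATOR LEVEL (any commutative ring of scalars; `V` = functions on T_η, `W` = multi-scale averages on
   𝔅 = ⋃Λ_j, `A` = vector fields, `WA` = bond averages): `tildeOp S Q′ Q′* E = S − SQ′*EQ′S` — the common shape of 𝒢
   (2.27) (S = G′²) and of G̃_j (2.131) (S = G_j) — with the printed annihilation identities `Q′𝒢 = 0`, `𝒢Q′* = 0`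
   (`comp_tildeOp_eq_zero`, `tildeOp_comp_eq_zero`); `deltaPrime` (2.13)–(2.14) Δ′_a = Δ + Q′*aQ′; `repr217` = the
   right-hand side of (2.17); `calG` (2.27); the sentence *"This formula, the equality (2.26) and the equalities
   Q′𝒢 = 𝒢Q′* = 0 imply the representation (2.17)"* PROVED (`deltaPrime_calG_deltaPrime`, `conj_calG_eq_lap_calG_lap`);
   `repr217` is idempotent, maps into Δ′N(Q′) and fixes Δ′N(Q′) (`repr217_comp_self`, `repr217_mem_map_ker`,
   `repr217_apply_deltaPrime_of_mem_ker`), and Δ′N(Q′) = ΔN(Q′) (`map_deltaPrime_ker_eq`).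
2. HILBERT-SPACE LEVEL (real inner product spaces, G′ symmetric, Q′* the adjoint of Q′ for the pairings (2.14)/(2.15)):
   f − Rf ⊥ Δ′N(Q′) (`inner_sub_repr217_eq_zero`), hence **(2.17): the printed formula IS the orthogonal projection onto
   ΔN(Q′)** (`starProjection_eq_repr217`, via Mathlib's `Submodule.eq_starProjection_of_mem_of_inner_eq_zero`) and the
   minimum property (2.13) (`norm_sub_repr217_le`); uniqueness of the minimiser λ₀ on each orbit from injectivity of Δ
   on N(Q′), the qualitative content of (2.11) (`orbitMinimiser_unique`; the quantitative (2.11) is B4's block bound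
   (2.27), typed in `…Balaban1983to89.B4`).
3. THE CRITICAL CONFIGURATION (2.21) ⇒ (2.35), exactly as argued on pp. 226–228 with the Faddeev–Popov identities
   (2.31), (2.34) and the invertibility of Δ_a and of QGQ* as the NAMED HYPOTHESES the text itself singles out:
   `deltaA` (2.19), `hOp` (2.35) H = GQ*(QGQ*)⁻¹, uniqueness `critical221_unique` (λ = 0, ω = (QGQ*)⁻¹B, A = HB) and
   existence `critical221_exists`; the defining properties QH = I, R∂*H = 0 of H are `B5.hk_props` (same algebra as B5
   (1.95)/(1.103), not restated).  (2.31), (2.34) themselves are derived in print by Gaussian integration (2.24)–(2.33);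
   that derivation is not reproduced here (it is the located, prose-certified census material of the cell, C-B6-2).
4. THE GENERATOR IDENTITY (2.38) in any ring (`generator238`): from Σ_□ h_□² = 1 (2.36) and the locality
   *"G′(□) is an inverse of Δ′_a [on the support of h_□]"*, Δ′_aG′₀ = 1 − Σ_□ K(h_□)G′(□)h_□ with
   K(h) := hΔ′_a − Δ′_ah (the commutator whose explicit lattice form is the printed (2.39), not re-derived); the
   resummation (2.50) G′ = G′₀(I − R)⁻¹ is `B5.neumann_resummation`, its convergence bookkeeping `B6.neumann_majorant`.
5. (v1.1, §5, append-only) THE COVARIANCE 𝒢 of (2.25)–(2.27): `calG` inverts Δ′² on N(Q′), is symmetric, ranges in N(Q′)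
   (`calG_apply_deltaPrime_sq_of_mem_ker`, `inner_calG_comm`), and these three properties — the defining properties of
   the covariance of the constrained Gaussian (2.25) — determine an operator uniquely (`covariance_unique`), so 𝒢 = (2.27)
   (`eq_calG_of_covariance`); (2.31)/(2.34) are PROVED in the sibling `…B6Eq231` (p239491).
NOT HERE (by design, see the reader's SKELETON rows): the Gaussian integrals themselves (2.24)–(2.25), (2.28)–(2.30),
(2.32)–(2.33), the G(Ω) variant of p. 228 (`…B6GOmega`), the recursion a_j (`B1.aSeq`, [1] (2.13)/(2.15)), anything from
(2.36) on except (2.37)–(2.38).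
-/

namespace Literature.MathematicalPhysics.QuantumFieldTheory.Balaban1983to89.B6SectA

open scoped BigOperators

/-! ## §1. The operators of Sect. A at the abstract linear level -/

section Algebra

variable {R : Type*} [CommRing R]
variable {V W : Type*} [AddCommGroup V] [Module R V] [AddCommGroup W] [Module R W]

/-- The "tilde" of an operator `S` on `V` relative to an averaging `Q′ : V → W` with adjoint `Q′*` and an inverse `E`
of `Q′SQ′*`: `S̃ = S − SQ′*(Q′SQ′*)⁻¹Q′S`.  With `S = G′²` this is 𝒢 of (2.27) p. 227; with `S = G_j`, `Q′ = Q_j` it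
is `G̃_j = G_j − G_jQ_j*(Q_jG_jQ_j*)⁻¹Q_jG_j` of (2.131) p. 246. [cite: Balaban1984PropagatorsII, (2.27) p.227 + (2.131) p.246] -/
def tildeOp (S : V →ₗ[R] V) (Qp : V →ₗ[R] W) (Qps : W →ₗ[R] V) (E : W →ₗ[R] W) : V →ₗ[R] V :=
  S - S ∘ₗ Qps ∘ₗ E ∘ₗ Qp ∘ₗ S

/-- p. 227: *"the equalities Q′𝒢 = 𝒢Q′* = 0"* — first half, `Q′S̃ = 0`, whenever `E` is a right inverse of `Q′SQ′*`.
[cite: Balaban1984PropagatorsII, p.227 after (2.27)] -/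
theorem comp_tildeOp_eq_zero (S : V →ₗ[R] V) (Qp : V →ₗ[R] W) (Qps : W →ₗ[R] V) (E : W →ₗ[R] W)
    (hE : (Qp ∘ₗ S ∘ₗ Qps) ∘ₗ E = LinearMap.id) : Qp ∘ₗ tildeOp S Qp Qps E = 0 := by
  have hE' : ∀ w, Qp (S (Qps (E w))) = w := fun w => by
    simpa using LinearMap.congr_fun hE w
  ext v
  simp [tildeOp, hE']

/-- p. 227: *"the equalities Q′𝒢 = 𝒢Q′* = 0"* — second half, `S̃Q′* = 0`, whenever `E` is a left inverse of `Q′SQ′*`.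
[cite: Balaban1984PropagatorsII, p.227 after (2.27)] -/
theorem tildeOp_comp_eq_zero (S : V →ₗ[R] V) (Qp : V →ₗ[R] W) (Qps : W →ₗ[R] V) (E : W →ₗ[R] W)
    (hE : E ∘ₗ (Qp ∘ₗ S ∘ₗ Qps) = LinearMap.id) : tildeOp S Qp Qps E ∘ₗ Qps = 0 := by
  have hE' : ∀ w, E (Qp (S (Qps w))) = w := fun w => by
    simpa using LinearMap.congr_fun hE w
  ext w
  simp [tildeOp, hE']

/-- (2.13)–(2.14) p. 225: `Δ′_a = Δ + Q′*aQ′` — the Laplacian plus the weighted square of the multi-scale averaging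
`Q′ = (Q′_j)_{j=0..k}` ((Q′₀λ)(x) = λ(x) on Λ₀), the weight `a` acting on `W` = functions on 𝔅 as multiplication by
`a_j(L^jη)^{d−2}` on Λ_j (the numbers a_j of [1] (2.13)/(2.15) = tree `B1.aSeq`). [cite: Balaban1984PropagatorsII, (2.13)–(2.14) p.225] -/
def deltaPrime (lap : V →ₗ[R] V) (Qp : V →ₗ[R] W) (Qps : W →ₗ[R] V) (a : W →ₗ[R] W) : V →ₗ[R] V :=
  lap + Qps ∘ₗ a ∘ₗ Qp

/-- The gauge space (2.7)/(2.10) p. 224–225: `N(Q′) = {λ : λ = 0 on Λ₀, Q′_jλ = 0 on Λ_j} = ker Q′` (with Q′₀ = the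
restriction to Λ₀, as the text assumes after (2.14)). [cite: Balaban1984PropagatorsII, (2.7) + (2.10) pp.224–225] -/
abbrev gaugeSpace (Qp : V →ₗ[R] W) : Submodule R V := LinearMap.ker Qp

/-- On the gauge space `Δ′_a = Δ`: for `λ ∈ N(Q′)`, `Δ′_aλ = Δλ` (*"Of course Q′λ = 0, hence Rf = Δλ = Δ′_aλ"*, p. 225).
[cite: Balaban1984PropagatorsII, p.225 before (2.17)] -/
theorem deltaPrime_apply_of_mem_ker (lap : V →ₗ[R] V) (Qp : V →ₗ[R] W) (Qps : W →ₗ[R] V) (a : W →ₗ[R] W)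
    {n : V} (hn : n ∈ gaugeSpace Qp) : deltaPrime lap Qp Qps a n = lap n := by
  have hn' : Qp n = 0 := hn
  simp [deltaPrime, hn']

/-- Hence the target space of the projection `R` (p. 225: *"onto the subspace ΔN(Q′)"*) is the same whether written with
Δ or with Δ′_a: `Δ′_a N(Q′) = Δ N(Q′)`. [cite: Balaban1984PropagatorsII, (2.10)–(2.13) p.225] -/
theorem map_deltaPrime_ker_eq (lap : V →ₗ[R] V) (Qp : V →ₗ[R] W) (Qps : W →ₗ[R] V) (a : W →ₗ[R] W) :
    (gaugeSpace Qp).map (deltaPrime lap Qp Qps a) = (gaugeSpace Qp).map lap := by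
  ext v
  constructor
  · rintro ⟨n, hn, rfl⟩
    exact ⟨n, hn, (deltaPrime_apply_of_mem_ker lap Qp Qps a hn).symm⟩
  · rintro ⟨n, hn, rfl⟩
    exact ⟨n, hn, deltaPrime_apply_of_mem_ker lap Qp Qps a hn⟩

/-- The right-hand side of (2.17) p. 225: `Rf = f − G′Q′*(Q′G′²Q′*)⁻¹Q′G′f`, with `G′ = Δ′_a⁻¹` and `E` an inverse of
`Q′G′²Q′*` (which *"is well defined and positive"*, p. 225, from (2.11)). [cite: Balaban1984PropagatorsII, (2.17) p.225] -/
def repr217 (Gp : V →ₗ[R] V) (Qp : V →ₗ[R] W) (Qps : W →ₗ[R] V) (E : W →ₗ[R] W) : V →ₗ[R] V :=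
  LinearMap.id - Gp ∘ₗ Qps ∘ₗ E ∘ₗ Qp ∘ₗ Gp

/-- 𝒢 of (2.26)–(2.27) p. 226–227 (the covariance of the Gaussian integral (2.25)):
`𝒢 = G′² − G′²Q′*(Q′G′²Q′*)⁻¹Q′G′²` = `tildeOp (G′ ∘ G′)`. [cite: Balaban1984PropagatorsII, (2.27) p.227] -/
abbrev calG (Gp : V →ₗ[R] V) (Qp : V →ₗ[R] W) (Qps : W →ₗ[R] V) (E : W →ₗ[R] W) : V →ₗ[R] V :=
  tildeOp (Gp ∘ₗ Gp) Qp Qps E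

/-- p. 227, *"This formula [(2.27)], the equality (2.26) [R = Δ𝒢Δ] … imply the representation (2.17)"* — the algebra,
KERNEL-CHECKED: if `G′` is a two-sided inverse of `Δ′_a` then `Δ′_a𝒢Δ′_a = 1 − G′Q′*EQ′G′`. [cite: Balaban1984PropagatorsII, (2.26)–(2.27) ⇒ (2.17) p.227] -/
theorem deltaPrime_calG_deltaPrime (Dp Gp : V →ₗ[R] V) (Qp : V →ₗ[R] W) (Qps : W →ₗ[R] V) (E : W →ₗ[R] W)
    (hl : Dp ∘ₗ Gp = LinearMap.id) (hr : Gp ∘ₗ Dp = LinearMap.id) :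
    Dp ∘ₗ calG Gp Qp Qps E ∘ₗ Dp = repr217 Gp Qp Qps E := by
  have hl' : ∀ x, Dp (Gp x) = x := fun x => by simpa using LinearMap.congr_fun hl x
  have hr' : ∀ x, Gp (Dp x) = x := fun x => by simpa using LinearMap.congr_fun hr x
  ext v
  simp [calG, tildeOp, repr217, hl', hr']

/-- p. 227, the role of *"the equalities Q′𝒢 = 𝒢Q′* = 0"*: they let one replace Δ by `Δ′_a = Δ + Q′*aQ′` on both
sides of 𝒢, `(Δ + Q′*aQ′)𝒢(Δ + Q′*aQ′) = Δ𝒢Δ`, so that (2.26) `R = Δ𝒢Δ` and `deltaPrime_calG_deltaPrime` give (2.17).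
KERNEL-CHECKED for a two-sided inverse `E` of `Q′G′²Q′*`. [cite: Balaban1984PropagatorsII, (2.26)–(2.27) p.227] -/
theorem conj_calG_eq_lap_calG_lap (lap Gp : V →ₗ[R] V) (Qp : V →ₗ[R] W) (Qps : W →ₗ[R] V) (a E : W →ₗ[R] W)
    (hE1 : (Qp ∘ₗ (Gp ∘ₗ Gp) ∘ₗ Qps) ∘ₗ E = LinearMap.id) (hE2 : E ∘ₗ (Qp ∘ₗ (Gp ∘ₗ Gp) ∘ₗ Qps) = LinearMap.id) :
    deltaPrime lap Qp Qps a ∘ₗ calG Gp Qp Qps E ∘ₗ deltaPrime lap Qp Qps a =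
      lap ∘ₗ calG Gp Qp Qps E ∘ₗ lap := by
  have h1 : ∀ v, Qp (calG Gp Qp Qps E v) = 0 := fun v => by
    simpa using LinearMap.congr_fun (comp_tildeOp_eq_zero (Gp ∘ₗ Gp) Qp Qps E hE1) v
  have h2 : ∀ w, calG Gp Qp Qps E (Qps w) = 0 := fun w => by
    simpa using LinearMap.congr_fun (tildeOp_comp_eq_zero (Gp ∘ₗ Gp) Qp Qps E hE2) w
  ext v
  simp only [deltaPrime, LinearMap.coe_comp, Function.comp_apply, LinearMap.add_apply, map_add, h2, add_zero, h1,
    map_zero]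

/-- `R` of (2.17) is idempotent (E a right inverse of Q′G′²Q′*). [cite: Balaban1984PropagatorsII, (2.17) p.225] -/
theorem repr217_comp_self (Gp : V →ₗ[R] V) (Qp : V →ₗ[R] W) (Qps : W →ₗ[R] V) (E : W →ₗ[R] W)
    (hE1 : (Qp ∘ₗ (Gp ∘ₗ Gp) ∘ₗ Qps) ∘ₗ E = LinearMap.id) :
    repr217 Gp Qp Qps E ∘ₗ repr217 Gp Qp Qps E = repr217 Gp Qp Qps E := by
  have hE' : ∀ w, Qp (Gp (Gp (Qps (E w)))) = w := fun w => by simpa using LinearMap.congr_fun hE1 w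
  ext v
  simp [repr217, map_sub, hE']

/-- `R` of (2.17) maps into `Δ′_aN(Q′)` (= ΔN(Q′), `map_deltaPrime_ker_eq`): `Rf = Δ′_a(G′Rf)` with `Q′(G′Rf) = 0` —
the printed *"Of course Q′λ = 0"* for `λ = G′f − G′²Q′*(Q′G′²Q′*)⁻¹Q′G′f` (p. 225). [cite: Balaban1984PropagatorsII, (2.16)–(2.17) p.225] -/
theorem repr217_mem_map_ker (Dp Gp : V →ₗ[R] V) (Qp : V →ₗ[R] W) (Qps : W →ₗ[R] V) (E : W →ₗ[R] W)
    (hl : Dp ∘ₗ Gp = LinearMap.id) (hE1 : (Qp ∘ₗ (Gp ∘ₗ Gp) ∘ₗ Qps) ∘ₗ E = LinearMap.id) (f : V) :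
    repr217 Gp Qp Qps E f ∈ (gaugeSpace Qp).map Dp := by
  have hl' : ∀ x, Dp (Gp x) = x := fun x => by simpa using LinearMap.congr_fun hl x
  have hE' : ∀ w, Qp (Gp (Gp (Qps (E w)))) = w := fun w => by simpa using LinearMap.congr_fun hE1 w
  refine ⟨Gp (repr217 Gp Qp Qps E f), ?_, ?_⟩
  · show Qp (Gp (repr217 Gp Qp Qps E f)) = 0
    simp [repr217, map_sub, hE']
  · exact hl' _

/-- `R` of (2.17) fixes `Δ′_aN(Q′)` pointwise (G′ a right inverse of Δ′_a). [cite: Balaban1984PropagatorsII, (2.17) p.225] -/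
theorem repr217_apply_deltaPrime_of_mem_ker (Dp Gp : V →ₗ[R] V) (Qp : V →ₗ[R] W) (Qps : W →ₗ[R] V)
    (E : W →ₗ[R] W) (hr : Gp ∘ₗ Dp = LinearMap.id) {n : V} (hn : n ∈ gaugeSpace Qp) :
    repr217 Gp Qp Qps E (Dp n) = Dp n := by
  have hr' : ∀ x, Gp (Dp x) = x := fun x => by simpa using LinearMap.congr_fun hr x
  have hn' : Qp n = 0 := hn
  simp [repr217, hr', hn']

/-- If the Laplacian is injective on the gauge space — the qualitative content of (2.11) p. 225, *"the Laplace operator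
Δ is positive on the subspace N(Q′), hence it is invertible on this subspace"* (the quantitative bound is [3] (2.26)–(2.27)
= tree `…Balaban1983to89.B4`) — then the orbit minimiser λ₀ of (2.8)/(2.13) with prescribed value `Δλ₀` is unique:
*"this equation has exactly one solution"*. [cite: Balaban1984PropagatorsII, (2.11)–(2.12) p.225] -/
theorem orbitMinimiser_unique (lap : V →ₗ[R] V) (Qp : V →ₗ[R] W)
    (hinj : ∀ n ∈ gaugeSpace Qp, lap n = 0 → n = 0) {l₁ l₂ : V} (h₁ : l₁ ∈ gaugeSpace Qp)
    (h₂ : l₂ ∈ gaugeSpace Qp) (heq : lap l₁ = lap l₂) : l₁ = l₂ := by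
  have hsub : l₁ - l₂ ∈ gaugeSpace Qp := Submodule.sub_mem _ h₁ h₂
  have h0 : lap (l₁ - l₂) = 0 := by rw [map_sub, heq, sub_self]
  exact sub_eq_zero.mp (hinj _ hsub h0)

end Algebra

/-! ## §2. (2.17) is the orthogonal projection onto `ΔN(Q′)` (real inner product spaces) -/

section Projection

variable {V W : Type*} [NormedAddCommGroup V] [InnerProductSpace ℝ V] [NormedAddCommGroup W]
  [InnerProductSpace ℝ W]

/-- The orthogonality behind (2.17): for `G′` symmetric (it is `Δ′_a⁻¹`, Δ′_a a positive quadratic form, p. 225),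
`Q′*` the adjoint of `Q′` for the pairings (2.14)/(2.15), `G′` a left inverse of `Δ′_a`: `f − Rf ⊥ Δ′_aN(Q′)`.
[cite: Balaban1984PropagatorsII, (2.13)–(2.17) p.225] -/
theorem inner_sub_repr217_eq_zero (Dp Gp : V →ₗ[ℝ] V) (Qp : V →ₗ[ℝ] W) (Qps : W →ₗ[ℝ] V) (E : W →ₗ[ℝ] W)
    (hsym : ∀ x y : V, inner ℝ (Gp x) y = inner ℝ x (Gp y))
    (hadj : ∀ (w : W) (v : V), inner ℝ (Qps w) v = inner ℝ w (Qp v))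
    (hr : Gp ∘ₗ Dp = LinearMap.id) (f : V) {n : V} (hn : n ∈ gaugeSpace Qp) :
    inner ℝ (f - repr217 Gp Qp Qps E f) (Dp n) = 0 := by
  have hr' : ∀ x, Gp (Dp x) = x := fun x => by simpa using LinearMap.congr_fun hr x
  have hn' : Qp n = 0 := hn
  have hdiff : f - repr217 Gp Qp Qps E f = Gp (Qps (E (Qp (Gp f)))) := by
    simp [repr217]
  rw [hdiff, hsym, hr', hadj, hn', inner_zero_right]

/-- **(2.17) p. 225, PROVED:** with `R` *"an orthogonal projection in the space L²(T_η) onto the subspace ΔN(Q′)"*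
(p. 225) and `K = Δ′_aN(Q′)` (= ΔN(Q′) by `map_deltaPrime_ker_eq`), `Rf = f − G′Q′*(Q′G′²Q′*)⁻¹Q′G′f` for every f,
under: `G′` a two-sided inverse of `Δ′_a` and symmetric, `Q′*` the adjoint of `Q′`, `E` a right inverse of `Q′G′²Q′*`.
[cite: Balaban1984PropagatorsII, (2.17) p.225] -/
theorem starProjection_eq_repr217 (Dp Gp : V →ₗ[ℝ] V) (Qp : V →ₗ[ℝ] W) (Qps : W →ₗ[ℝ] V) (E : W →ₗ[ℝ] W)
    (hsym : ∀ x y : V, inner ℝ (Gp x) y = inner ℝ x (Gp y))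
    (hadj : ∀ (w : W) (v : V), inner ℝ (Qps w) v = inner ℝ w (Qp v))
    (hl : Dp ∘ₗ Gp = LinearMap.id) (hr : Gp ∘ₗ Dp = LinearMap.id)
    (hE1 : (Qp ∘ₗ (Gp ∘ₗ Gp) ∘ₗ Qps) ∘ₗ E = LinearMap.id)
    (K : Submodule ℝ V) [K.HasOrthogonalProjection] (hK : K = (gaugeSpace Qp).map Dp) (f : V) :
    K.starProjection f = repr217 Gp Qp Qps E f := by
  subst hK
  refine Submodule.eq_starProjection_of_mem_of_inner_eq_zero
    (repr217_mem_map_ker Dp Gp Qp Qps E hl hE1 f) ?_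
  rintro w ⟨n, hn, rfl⟩
  exact inner_sub_repr217_eq_zero Dp Gp Qp Qps E hsym hadj hr f hn

/-- The variational characterisation (2.13) p. 225, PROVED: `λ ↦ ‖f − Δ′_aλ‖` over `λ ∈ N(Q′)` is minimised at the λ of
(2.16)–(2.17), i.e. `‖f − Rf‖ ≤ ‖f − Δ′_aλ‖` for every `λ ∈ N(Q′)` (Pythagoras with `inner_sub_repr217_eq_zero`).
[cite: Balaban1984PropagatorsII, (2.13) p.225] -/
theorem norm_sub_repr217_le (Dp Gp : V →ₗ[ℝ] V) (Qp : V →ₗ[ℝ] W) (Qps : W →ₗ[ℝ] V) (E : W →ₗ[ℝ] W)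
    (hsym : ∀ x y : V, inner ℝ (Gp x) y = inner ℝ x (Gp y))
    (hadj : ∀ (w : W) (v : V), inner ℝ (Qps w) v = inner ℝ w (Qp v))
    (hl : Dp ∘ₗ Gp = LinearMap.id) (hr : Gp ∘ₗ Dp = LinearMap.id)
    (hE1 : (Qp ∘ₗ (Gp ∘ₗ Gp) ∘ₗ Qps) ∘ₗ E = LinearMap.id) (f : V) {n : V} (hn : n ∈ gaugeSpace Qp) :
    ‖f - repr217 Gp Qp Qps E f‖ ≤ ‖f - Dp n‖ := by
  set T := repr217 Gp Qp Qps E with hT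
  -- `T f − Δ′n ∈ Δ′N(Q′)`, so it is orthogonal to `f − T f`
  obtain ⟨m, hm, hmT⟩ := repr217_mem_map_ker Dp Gp Qp Qps E hl hE1 f
  have hmem : m - n ∈ gaugeSpace Qp := Submodule.sub_mem _ hm hn
  have hortho : inner ℝ (f - T f) (T f - Dp n) = 0 := by
    have : T f - Dp n = Dp (m - n) := by rw [map_sub, hmT]
    rw [this]
    exact inner_sub_repr217_eq_zero Dp Gp Qp Qps E hsym hadj hr f hmem
  have hdecomp : f - Dp n = (f - T f) + (T f - Dp n) := by abel
  have hpy : ‖f - Dp n‖ * ‖f - Dp n‖ =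
      ‖f - T f‖ * ‖f - T f‖ + ‖T f - Dp n‖ * ‖T f - Dp n‖ := by
    rw [hdecomp]
    exact norm_add_sq_eq_norm_sq_add_norm_sq_of_inner_eq_zero _ _ hortho
  nlinarith [norm_nonneg (f - Dp n), norm_nonneg (f - T f), norm_nonneg (T f - Dp n)]

end Projection

/-! ## §3. The critical configuration: (2.19)–(2.23) with (2.31), (2.34) ⇒ (2.35) -/

section Critical

variable {R : Type*} [CommRing R]
variable {V A W : Type*} [AddCommGroup V] [Module R V] [AddCommGroup A] [Module R A] [AddCommGroup W]
  [Module R W]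

/-- (2.19) p. 226: `Δ_a = ∂*∂ + ∂R∂* + Q*aQ = Δ − ∂P∂* + Q*aQ` on vector fields (`lapA` = Δ = ∂*∂ + ∂∂* on vector
fields, `P = I − R`, `Q` of (2.20): (QA)(b) = (Q_jA)(b) for b ∈ Λ_j, (Q₀A)(b) = A(b)). [cite: Balaban1984PropagatorsII, (2.19)–(2.20) p.226] -/
def deltaA (lapA : A →ₗ[R] A) (d : V →ₗ[R] A) (dstar : A →ₗ[R] V) (P : V →ₗ[R] V) (Q : A →ₗ[R] W)
    (Qs : W →ₗ[R] A) (a : W →ₗ[R] W) : A →ₗ[R] A :=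
  lapA - d ∘ₗ P ∘ₗ dstar + Qs ∘ₗ a ∘ₗ Q

/-- Unfolding of (2.19): the two printed forms agree when `Δ = ∂*∂ + ∂∂*` on vector fields and `P = I − R`, i.e.
`∂*∂ + ∂R∂* + Q*aQ = Δ − ∂P∂* + Q*aQ`. [cite: Balaban1984PropagatorsII, (2.19) p.226] -/
theorem deltaA_eq_of_hodge (lapA : A →ₗ[R] A) (d : V →ₗ[R] A) (dstar : A →ₗ[R] V) (Rp P : V →ₗ[R] V)
    (Q : A →ₗ[R] W) (Qs : W →ₗ[R] A) (a : W →ₗ[R] W) (dstarA : A →ₗ[R] A)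
    (hlap : lapA = dstarA + d ∘ₗ dstar) (hP : P = LinearMap.id - Rp) :
    deltaA lapA d dstar P Q Qs a = dstarA + d ∘ₗ Rp ∘ₗ dstar + Qs ∘ₗ a ∘ₗ Q := by
  subst hlap hP
  ext v
  simp [deltaA, map_sub]
  abel

/-- (2.35) p. 228: `H = GQ*(QGQ*)⁻¹` (the same representation as B5 (1.103); `E` = the inverse of `QGQ*`, which is
*"a well-defined and positive operator"* because `G` is positive). [cite: Balaban1984PropagatorsII, (2.35) p.228] -/
def hOp (G : A →ₗ[R] A) (Qs : W →ₗ[R] A) (E : W →ₗ[R] W) : W →ₗ[R] A :=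
  G ∘ₗ Qs ∘ₗ E

/-- **(2.21) ⇒ (2.35), uniqueness, PROVED as printed (pp. 226–228).**  Let `G` be a left inverse of `Δ_a` (*"the
operator Δ_a is bounded from below by a positive constant, hence the first equation implies A = G∂Rλ + GQ*ω (2.22)"*),
let the Faddeev–Popov identities (2.31) `R∂*G∂R = R` and (2.34) `R∂*GQ* = 0` hold, and let `E` be a left inverse of
`QGQ*`.  Then every solution `(A, λ, ω)`, `Rλ = λ`, of the critical-point equations (2.21)
`Δ_aA − ∂Rλ − Q*ω = 0`, `R∂*A = 0`, `QA = B` has `λ = 0`, `ω = (QGQ*)⁻¹B` and `A = HB = GQ*(QGQ*)⁻¹B`: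
*"The first equation is simply Rλ = λ = 0, and the second is QGQ*ω = B. … We get ω = (QGQ*)⁻¹B, and from (2.22) we
obtain finally A = HB = GQ*(QGQ*)⁻¹B. (2.35)"* [cite: Balaban1984PropagatorsII, (2.21)–(2.23) + (2.31) + (2.34)–(2.35) pp.226–228] -/
theorem critical221_unique (ΔA G : A →ₗ[R] A) (d : V →ₗ[R] A) (dstar : A →ₗ[R] V) (Rp : V →ₗ[R] V)
    (Q : A →ₗ[R] W) (Qs : W →ₗ[R] A) (E : W →ₗ[R] W)
    (hG : G ∘ₗ ΔA = LinearMap.id)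
    (h231 : Rp ∘ₗ dstar ∘ₗ G ∘ₗ d ∘ₗ Rp = Rp)
    (h234 : Rp ∘ₗ dstar ∘ₗ G ∘ₗ Qs = 0)
    (hE : E ∘ₗ (Q ∘ₗ G ∘ₗ Qs) = LinearMap.id)
    {B : W} {A' : A} {lam : V} {ω : W}
    (hR : Rp lam = lam) (h1 : ΔA A' - d (Rp lam) - Qs ω = 0) (h2 : Rp (dstar A') = 0) (h3 : Q A' = B) :
    lam = 0 ∧ ω = E B ∧ A' = hOp G Qs E B := by
  have hG' : ∀ x, G (ΔA x) = x := fun x => by simpa using LinearMap.congr_fun hG x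
  have h231' : ∀ x, Rp (dstar (G (d (Rp x)))) = Rp x := fun x => by
    simpa using LinearMap.congr_fun h231 x
  have h234' : ∀ w, Rp (dstar (G (Qs w))) = 0 := fun w => by
    simpa using LinearMap.congr_fun h234 w
  have hE' : ∀ w, E (Q (G (Qs w))) = w := fun w => by simpa using LinearMap.congr_fun hE w
  -- (2.22): A = G∂Rλ + GQ*ω
  have h1' : ΔA A' = d (Rp lam) + Qs ω := by
    rw [sub_sub, sub_eq_zero] at h1
    exact h1
  have h222 : A' = G (d (Rp lam)) + G (Qs ω) := by
    rw [← map_add, ← h1', hG']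
  -- (2.23)₁ with (2.31), (2.34): Rλ = λ = 0
  have hlam : lam = 0 := by
    have := h2
    rw [h222, map_add, map_add, h231', h234', add_zero, hR] at this
    exact this
  -- (2.23)₂: QGQ*ω = B, hence ω = E B
  have hω : ω = E B := by
    have hQ := h3
    rw [h222, hlam, map_zero, map_zero, map_zero, zero_add] at hQ
    rw [← hQ, hE']
  refine ⟨hlam, hω, ?_⟩
  rw [h222, hlam, hω, map_zero, map_zero, map_zero, zero_add]
  rfl

/-- **(2.35) solves (2.21), existence, PROVED:** with `G` a right inverse of `Δ_a`, (2.34) `R∂*GQ* = 0` and `E` a right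
inverse of `QGQ*`, the triple `A = HB`, `λ = 0`, `ω = (QGQ*)⁻¹B` satisfies the three critical-point equations (2.21)
(and trivially `Rλ = λ`): *"Thus we have proved that there exists exactly one solution of the equations (2.21), hence
exactly one critical configuration of (2.5) satisfying (2.6), (2.12), and given by (2.35)."* [cite: Balaban1984PropagatorsII, (2.21) + (2.35) pp.226–228] -/
theorem critical221_exists (ΔA G : A →ₗ[R] A) (d : V →ₗ[R] A) (dstar : A →ₗ[R] V) (Rp : V →ₗ[R] V)
    (Q : A →ₗ[R] W) (Qs : W →ₗ[R] A) (E : W →ₗ[R] W)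
    (hG : ΔA ∘ₗ G = LinearMap.id) (h234 : Rp ∘ₗ dstar ∘ₗ G ∘ₗ Qs = 0)
    (hE : (Q ∘ₗ G ∘ₗ Qs) ∘ₗ E = LinearMap.id) (B : W) :
    Rp (0 : V) = 0 ∧
      ΔA (hOp G Qs E B) - d (Rp 0) - Qs (E B) = 0 ∧ Rp (dstar (hOp G Qs E B)) = 0 ∧ Q (hOp G Qs E B) = B := by
  have hG' : ∀ x, ΔA (G x) = x := fun x => by simpa using LinearMap.congr_fun hG x
  have h234' : ∀ w, Rp (dstar (G (Qs w))) = 0 := fun w => by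
    simpa using LinearMap.congr_fun h234 w
  have hE' : ∀ w, Q (G (Qs (E w))) = w := fun w => by simpa using LinearMap.congr_fun hE w
  refine ⟨map_zero Rp, ?_, ?_, ?_⟩
  · simp [hOp, hG']
  · simp [hOp, h234']
  · simp [hOp, hE']

end Critical

/-! ## §4. The generator identity (2.37)–(2.38) of the random-walk expansion, in any ring -/

section Generator

variable {𝔄 : Type*} [Ring 𝔄] {ι : Type*}

/-- **(2.38) p. 229, PROVED in any ring of operators.**  With a partition of unity `Σ_{□∈𝒟} h_□² = 1` (2.36), local
inverses `G′(□)` such that `Δ′_aG′(□) = I` on the support of `h_□` — typed as the operator identity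
`h_□Δ′_aG′(□)h_□ = h_□²` (*"G′(□) is an inverse of Δ′_a with some boundary conditions on the boundary of □"*, the
boundary being away from supp h_□) — and `K(h) := hΔ′_a − Δ′_ah` (whose explicit lattice form is the printed (2.39)),
the approximate inverse `G′₀ = Σ_□ h_□G′(□)h_□` (2.37) satisfies `Δ′_aG′₀ = I − Σ_□ K(h_□)G′(□)h_□ = I − R` (2.38).
The resummation `G′ = G′₀(I − R)⁻¹` (2.50) is then `B5.neumann_resummation`. [cite: Balaban1984PropagatorsII, (2.36)–(2.38) p.229] -/
theorem generator238 (s : Finset ι) (h g : ι → 𝔄) (D : 𝔄)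
    (hpart : ∑ i ∈ s, h i * h i = 1) (hloc : ∀ i ∈ s, h i * D * g i * h i = h i * h i) :
    D * ∑ i ∈ s, h i * g i * h i = 1 - ∑ i ∈ s, (h i * D - D * h i) * g i * h i := by
  have hterm : ∀ i ∈ s, D * (h i * g i * h i) = h i * h i - (h i * D - D * h i) * g i * h i := by
    intro i hi
    rw [← hloc i hi]
    noncomm_ring
  rw [Finset.mul_sum, Finset.sum_congr rfl hterm, Finset.sum_sub_distrib, hpart]

end Generator

/-! ## §5 (v1.1, append-only; rows `B6.Eq2.24`/`B6.Eq2.27` of `HOME/lit-balaban-r03/ROWS-B6.md`).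
(2.24)–(2.27): *"Let us denote by 𝒢 a covariance of the Gaussian integral on the right-hand side above [(2.25):
Z′⁻¹∫dλ δ(Q′λ) e^{−½‖Δλ‖² + ⟨Δf,λ⟩}]. Thus we have R = Δ𝒢Δ. (2.26) It is easy to see that
𝒢 = G′² − G′²Q′*(Q′G′²Q′*)⁻¹Q′G′². (2.27)"* — the "easy to see", KERNEL-CHECKED as linear algebra: the covariance of a
centred non-degenerate Gaussian on the subspace N(Q′) with density ∝ e^{−½⟨λ,Δ′²λ⟩} (‖Δλ‖ = ‖Δ′_aλ‖ on N(Q′)) is THE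
symmetric operator with range in N(Q′) that inverts Δ′² on N(Q′) (a textbook property of Gaussian covariances, which is
the only analytic input and is not formalised here); `calG` (2.27) has these three properties and they determine it. -/

section Covariance

variable {R : Type*} [CommRing R]
variable {V W : Type*} [AddCommGroup V] [Module R V] [AddCommGroup W] [Module R W]

/-- `𝒢` of (2.27) inverts `Δ′_a²` on the gauge space: `𝒢(Δ′_aΔ′_aλ) = λ` for `λ ∈ N(Q′)` (G′ a left inverse of Δ′_a).
[cite: Balaban1984PropagatorsII, (2.25)–(2.27) pp.226–227] -/
theorem calG_apply_deltaPrime_sq_of_mem_ker (Dp Gp : V →ₗ[R] V) (Qp : V →ₗ[R] W) (Qps : W →ₗ[R] V)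
    (E : W →ₗ[R] W) (hr : Gp ∘ₗ Dp = LinearMap.id) {n : V} (hn : n ∈ gaugeSpace Qp) :
    calG Gp Qp Qps E (Dp (Dp n)) = n := by
  have hr' : ∀ x, Gp (Dp x) = x := fun x => by simpa using LinearMap.congr_fun hr x
  have hn' : Qp n = 0 := hn
  simp [calG, tildeOp, hr', hn']

end Covariance

section CovarianceInner

variable {V W : Type*} [NormedAddCommGroup V] [InnerProductSpace ℝ V] [NormedAddCommGroup W]
  [InnerProductSpace ℝ W]

/-- `𝒢` of (2.27) is symmetric when `G′` is symmetric, `Q′*` is the adjoint of `Q′` and the inverse `E` of the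
symmetric operator `Q′G′²Q′*` is symmetric. [cite: Balaban1984PropagatorsII, (2.27) p.227] -/
theorem inner_calG_comm (Gp : V →ₗ[ℝ] V) (Qp : V →ₗ[ℝ] W) (Qps : W →ₗ[ℝ] V) (E : W →ₗ[ℝ] W)
    (hsym : ∀ x y : V, inner ℝ (Gp x) y = inner ℝ x (Gp y))
    (hadj : ∀ (w : W) (v : V), inner ℝ (Qps w) v = inner ℝ w (Qp v))
    (hE : ∀ w w' : W, inner ℝ (E w) w' = inner ℝ w (E w')) (u v : V) :
    inner ℝ (calG Gp Qp Qps E u) v = inner ℝ u (calG Gp Qp Qps E v) := by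
  have hadj' : ∀ (v : V) (w : W), inner ℝ v (Qps w) = inner ℝ (Qp v) w := fun v w => by
    rw [real_inner_comm, hadj, real_inner_comm]
  have e1 : inner ℝ (Gp (Gp u)) v = inner ℝ u (Gp (Gp v)) := by rw [hsym, hsym]
  have e2 : inner ℝ (Gp (Gp (Qps (E (Qp (Gp (Gp u))))))) v =
      inner ℝ (Qp (Gp (Gp u))) (E (Qp (Gp (Gp v)))) := by
    rw [hsym, hsym, hadj, hE]
  have e3 : inner ℝ u (Gp (Gp (Qps (E (Qp (Gp (Gp v))))))) =
      inner ℝ (Qp (Gp (Gp u))) (E (Qp (Gp (Gp v)))) := by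
    rw [← hsym, ← hsym, hadj']
  simp only [calG, tildeOp, LinearMap.sub_apply, LinearMap.coe_comp, Function.comp_apply]
  rw [inner_sub_left, inner_sub_right, e1, e2, e3]

/-- **Uniqueness of the covariance (the content of "It is easy to see that (2.27)").**  On a real inner-product space,
with `Δ′` symmetric and injective on `N(Q′)` (= positivity (2.11)), there is at most ONE operator `T` that (a) maps into
`N(Q′)`, (b) is symmetric, (c) satisfies `T(Δ′²λ) = λ` for `λ ∈ N(Q′)` — these are the defining properties of the
covariance operator of the centred Gaussian on `N(Q′)` with density ∝ `e^{−½‖Δ′λ‖²}` (2.25).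
[cite: Balaban1984PropagatorsII, (2.25)–(2.27) pp.226–227] -/
theorem covariance_unique (Dp : V →ₗ[ℝ] V) (Qp : V →ₗ[ℝ] W) (T₁ T₂ : V →ₗ[ℝ] V)
    (hDsym : ∀ x y : V, inner ℝ (Dp x) y = inner ℝ x (Dp y))
    (hDinj : ∀ n ∈ gaugeSpace Qp, Dp n = 0 → n = 0)
    (h₁r : ∀ u, T₁ u ∈ gaugeSpace Qp) (h₂r : ∀ u, T₂ u ∈ gaugeSpace Qp)
    (h₁s : ∀ x y : V, inner ℝ (T₁ x) y = inner ℝ x (T₁ y))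
    (h₂s : ∀ x y : V, inner ℝ (T₂ x) y = inner ℝ x (T₂ y))
    (h₁i : ∀ n ∈ gaugeSpace Qp, T₁ (Dp (Dp n)) = n) (h₂i : ∀ n ∈ gaugeSpace Qp, T₂ (Dp (Dp n)) = n) :
    T₁ = T₂ := by
  ext u
  have hw : T₁ u - T₂ u ∈ gaugeSpace Qp := Submodule.sub_mem _ (h₁r u) (h₂r u)
  set w := T₁ u - T₂ u with hwdef
  have h0 : inner ℝ (Dp w) (Dp w) = 0 := by
    calc inner ℝ (Dp w) (Dp w) = inner ℝ w (Dp (Dp w)) := hDsym _ _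
      _ = inner ℝ (T₁ u) (Dp (Dp w)) - inner ℝ (T₂ u) (Dp (Dp w)) := by rw [hwdef, inner_sub_left]
      _ = inner ℝ u (T₁ (Dp (Dp w))) - inner ℝ u (T₂ (Dp (Dp w))) := by rw [h₁s, h₂s]
      _ = 0 := by rw [h₁i w hw, h₂i w hw, sub_self]
  have hDw : Dp w = 0 := inner_self_eq_zero.mp h0
  exact sub_eq_zero.mp (hDinj w hw hDw)

/-- **(2.26)–(2.27), PROVED (modulo the textbook characterisation of a Gaussian covariance):** any operator with the
three covariance properties of `covariance_unique` — in particular the covariance `𝒢` of (2.25) — EQUALS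
`calG` = `G′² − G′²Q′*(Q′G′²Q′*)⁻¹Q′G′²`, under: `G′` a right inverse of `Δ′_a`, symmetric; `Δ′_a` symmetric;
`Q′*` the adjoint of `Q′`; `E` a symmetric right inverse of `Q′G′²Q′*`.  Combined with `conj_calG_eq_lap_calG_lap`,
`deltaPrime_calG_deltaPrime` and `starProjection_eq_repr217` this closes the printed chain (2.25) → (2.26) → (2.27) →
(2.17). [cite: Balaban1984PropagatorsII, (2.26)–(2.27) pp.226–227] -/
theorem eq_calG_of_covariance (Dp Gp T : V →ₗ[ℝ] V) (Qp : V →ₗ[ℝ] W) (Qps : W →ₗ[ℝ] V) (E : W →ₗ[ℝ] W)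
    (hDsym : ∀ x y : V, inner ℝ (Dp x) y = inner ℝ x (Dp y))
    (hsym : ∀ x y : V, inner ℝ (Gp x) y = inner ℝ x (Gp y))
    (hadj : ∀ (w : W) (v : V), inner ℝ (Qps w) v = inner ℝ w (Qp v))
    (hE : ∀ w w' : W, inner ℝ (E w) w' = inner ℝ w (E w'))
    (hr : Gp ∘ₗ Dp = LinearMap.id)
    (hE1 : (Qp ∘ₗ (Gp ∘ₗ Gp) ∘ₗ Qps) ∘ₗ E = LinearMap.id)
    (hTr : ∀ u, T u ∈ gaugeSpace Qp) (hTs : ∀ x y : V, inner ℝ (T x) y = inner ℝ x (T y))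
    (hTi : ∀ n ∈ gaugeSpace Qp, T (Dp (Dp n)) = n) :
    T = calG Gp Qp Qps E := by
  have hDinj : ∀ n ∈ gaugeSpace Qp, Dp n = 0 → n = 0 := by
    intro n _ hn0
    have := LinearMap.congr_fun hr n
    simpa [hn0] using this.symm
  have hGr : ∀ u, calG Gp Qp Qps E u ∈ gaugeSpace Qp := fun u => by
    show Qp (calG Gp Qp Qps E u) = 0
    simpa using LinearMap.congr_fun (comp_tildeOp_eq_zero (Gp ∘ₗ Gp) Qp Qps E hE1) u
  exact covariance_unique Dp Qp T (calG Gp Qp Qps E) hDsym hDinj hTr hGr hTs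
    (inner_calG_comm Gp Qp Qps E hsym hadj hE) hTi
    (fun n hn => calG_apply_deltaPrime_sq_of_mem_ker Dp Gp Qp Qps E hr hn)

end CovarianceInner


end Literature.MathematicalPhysics.QuantumFieldTheory.Balaban1983to89.B6SectA
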